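/-
Copyright (c) 2026 the pub-hodgecm-mathlib formalisation cell (harness21).  Prover seat hodgecm-mathlib-A-p19 (g29): road «S3-ram» (LEAD F0P3a-plan (g13); owner ∕ (α) keeper
F0P3a-p06 (g16); (Cnt2′) chair F0P3a-p07 (g15), plan 05:03:10Z (Z-Aeven)), the A-EVEN hyperbolic cells: `#R = q + 1` at root depth `N − 1`; 2026-09-02.
-/
import Literature.NumberTheory.Rogawski1990.TypeTwoRamifiedHyperbolicRootRegionCount               -- ★ p849388 (this seat): regime-B `#R`; brings FILES 1–4, ★ WSideBalls, ★ DepthDictionary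
import Literature.NumberTheory.Automorphic.UnitaryLatticeTreeBlockRootRegionAxisTop                -- ★ p849253 (F0P3a-p01 (g18)): (4c-ii) `ncard_rootRegion_eq_ncard_two_of_top`
import Literature.NumberTheory.Rogawski1990.DepthZeroKappaTransferTypeTwoRamifiedWSideLatticeCurrencyTotal   -- ★ (F0P3a-p05): `finite_selfDual_fixed_of_even_depth_ramified`
import HarnessLib

/-!
# THE ROOT REGION OF THE CENTRED HYPERBOLIC TYPE-(2) LITERAL IN REGIME A-EVEN (`N = 2n = m`): the `q + 1` self-dual axis vertices of level `ϖ^{N−1}` around the modular centre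
# (Kottwitz 1986 §3; Rogawski 1990 §4.9; Labesse–Langlands 1979 §2)

Topic `NumberTheory/Rogawski1990`; namespaces `Literature.NumberTheory.Automorphic.UnitaryLatticeTree` (§1, generic) and `Literature.NumberTheory.Rogawski1990.BlockLawHyp` (§2, CM).
THEOREMS ONLY (no definition, no instance, no notation, no named fact, no `sorry`); kernel lane `--supports stmt-HodgeConjecture-24833`.  Cell `pub/hodgecm-mathlib` (D-0151), crux
H413; road «S3-ram» (count-neutral): the (α) BLOCK-LAW skeleton, cells `stub_Zhyp_zero_even_A` ∕ `stub_Zhyp_pm_even_A` (chair F0P3a-p07 (g15) plan 05:03:10Z: the ODD raw head at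
root depth `N − 1 = 2(mA−1)+3`, `sR.card = q + 1`; pen split 05:05:33Z: these two cells are A-p19 (g29)'s).  THIS FILE gives the atom **`R = #R = q + 1`**: in regime A-even
(`m = N = 2n`, `|2û₀₀ − tr ĝ_w|_w < |ϖ^N|`, ★ chair dictionary clause 3) the root region of `Γ = ι(B₀, 1)` at level `ϖ^{N−1}` is counted by ★ (4c-ii) F0P3a-p01 (g18)
`ncard_rootRegion_eq_ncard_two_of_top` — whose `htop` («no W-vertex of centred depth `N`») is A-p12 (g25)'s ★ top-ball count `= 0` for `ĝ_w` (finite by ★ F0P3a-p05), TRANSPORTED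
to `B₀ = k⁻¹(s·ĝ_w)k` along `B ↦ k·B` (§1) — and then by FILE 4's W-side transport ∘ ★ A-p12 odd-scale collapse ∘ even-depth ball at `j = n − 1`: `(q+1)·Σ_{i<1} q^i = q + 1`.
HONEST LABEL: HC_CM is proved only modulo the 2 remaining named inputs (hLiu418 24832, h413 24833) until rung 0 closes; unconditional local algebra, count-neutral.

* §1 `mapGL_mem_centredBall_of_mem_centredBall_inv_conj_scalar_mul` (pointwise transport `B ↦ k·B` of the centred-ball membership), `centredBall_inv_conj_scalar_mul_eq_empty`.
* §2 **`ncard_rootRegion_hyperbolic_of_even_A_ram`** (`#R = q + 1` at level `ϖ^{2n−1}`; `htop` at `B₀` is obtained inline from A-p12's `ncard = 0` + F0P3a-p05's finiteness + §1).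

## References
* [Kottwitz1986] R. E. Kottwitz, *Base change for unit elements of Hecke algebras*, Compositio Math. 60 (1986), §3.
* [Rogawski1990] J. D. Rogawski, *Automorphic Representations of Unitary Groups in Three Variables*, Ann. of Math. Stud. 123 (1990), §4.9 pp. 54–56, Lemma 4.9.3.
* [LabesseLanglands1979] J.-P. Labesse, R. P. Langlands, *L-indistinguishability for SL(2)*, Canad. J. Math. 31 (1979), §2 Lemma 2.1 p. 8.
* [BruhatTits1972] F. Bruhat, J. Tits, *Groupes réductifs sur un corps local I*, Publ. Math. IHÉS 41 (1972), §10.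
-/

set_option autoImplicit false

noncomputable section

open scoped Valued WithZero Matrix MatrixGroups
open Polynomial NumberField IsDedekindDomain
open Literature.NumberTheory.Automorphic Literature.NumberTheory.Automorphic.HermitianLattice Literature.NumberTheory.Automorphic.UnitaryLatticeTree
open Literature.NumberTheory.Automorphic.UnitaryGroup Literature.NumberTheory.GaloisRepresentations
open Literature.NumberTheory.Rogawski1990

namespace Literature.NumberTheory.Automorphic.UnitaryLatticeTree

/-! ## §1 Pointwise transport of the centred-ball membership along `B ↦ k·B` -/

section Transport

variable {K : Type*} [Field K] [Valued K ℤᵐ⁰] {σ : K →+* K} {ϖ : K}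

/-- **`B ↦ k·B` carries the centred ball of `B₀ = k⁻¹(s·g)k` into the centred ball of `g`** (`k ∈ U(σ, H)`, `|s| = 1`, any scale `c ≠ 0`), pointwise: self-duality by ★
`isSelfDualLattice_formCongr_iff` (`ᵗσ̄k H k = H`), fixedness by ★ `mapGL_conj_mapGL_eq_iff` after dropping the unit scalar (★ `mapGL_eq_of_coe_eq_smul`), the centred token by ★
FILE 4 `coe_conj_scalar_mul_sub_half_trace_eq` ∘ ★ `map_toLin'_conj_mapGL_le_scaleLattice_iff` ∘ `map_toLin'_smul_le_scaleLattice_iff`. [cite: Kottwitz1986, §3] [cite: BruhatTits1972, §10] -/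
theorem mapGL_mem_centredBall_of_mem_centredBall_inv_conj_scalar_mul (H : Matrix (Fin 2) (Fin 2) K) {k : GL (Fin 2) K} (hk : k ∈ unitaryGroupOfForm σ H)
    (g : GL (Fin 2) K) {s : Kˣ} (hs : Valued.v (s : K) = 1) {c : K} (hc : c ≠ 0) {B : Submodule 𝒪[K] (Fin 2 → K)}
    (hB : B ∈ {M : Submodule 𝒪[K] (Fin 2 → K) | IsSelfDualLattice σ ϖ H M ∧ mapGL (k⁻¹ * (Matrix.GeneralLinearGroup.scalar (Fin 2) s * g) * k) M = M ∧
        M.map ((Matrix.toLin' (((k⁻¹ * (Matrix.GeneralLinearGroup.scalar (Fin 2) s * g) * k : GL (Fin 2) K) : Matrix (Fin 2) (Fin 2) K) -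
          (((k⁻¹ * (Matrix.GeneralLinearGroup.scalar (Fin 2) s * g) * k : GL (Fin 2) K) : Matrix (Fin 2) (Fin 2) K).trace / 2) • (1 : Matrix (Fin 2) (Fin 2) K))).restrictScalars 𝒪[K]) ≤
          scaleLattice c M}) :
    mapGL k B ∈ {M : Submodule 𝒪[K] (Fin 2 → K) | IsSelfDualLattice σ ϖ H M ∧ mapGL g M = M ∧
        M.map ((Matrix.toLin' ((g : Matrix (Fin 2) (Fin 2) K) - ((g : Matrix (Fin 2) (Fin 2) K).trace / 2) • (1 : Matrix (Fin 2) (Fin 2) K))).restrictScalars 𝒪[K]) ≤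
          scaleLattice c M} := by
  obtain ⟨hSD, hfix, htok⟩ := hB
  -- rewrite `k⁻¹ _ k` as `P _ P⁻¹` with `P = k⁻¹`
  have hPk : k⁻¹ * (Matrix.GeneralLinearGroup.scalar (Fin 2) s * g) * k = k⁻¹ * (Matrix.GeneralLinearGroup.scalar (Fin 2) s * g) * k⁻¹⁻¹ := by rw [inv_inv]
  have hkB : mapGL k⁻¹ (mapGL k B) = B := mapGL_inv_mapGL k B
  refine ⟨?_, ?_, ?_⟩
  · -- self-duality: `H = ᵗσ̄k H k`
    have h := (isSelfDualLattice_formCongr_iff (σ := σ) (ϖ := ϖ) k H B).1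
    rw [formCongr_eq_of_mem_unitaryGroupOfForm σ H hk] at h
    exact h hSD
  · -- fixedness: drop the scalar, then conjugate
    rw [hPk] at hfix
    rw [← hkB, mapGL_conj_mapGL_eq_iff] at hfix
    rwa [mapGL_eq_of_coe_eq_smul hs (coe_scalar_mul_eq_smul s g)] at hfix
  · -- the centred token
    rw [hPk, coe_conj_scalar_mul_sub_half_trace_eq, ← hkB, map_toLin'_conj_mapGL_le_scaleLattice_iff, map_toLin'_smul_le_scaleLattice_iff hs _ hc] at htok
    exact htok

/-- **Hence the centred ball of `B₀ = k⁻¹(s·g)k` at scale `c` is EMPTY when that of `g` is.** [cite: Kottwitz1986, §3] [cite: BruhatTits1972, §10] -/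
theorem centredBall_inv_conj_scalar_mul_eq_empty (H : Matrix (Fin 2) (Fin 2) K) {k : GL (Fin 2) K} (hk : k ∈ unitaryGroupOfForm σ H)
    (g : GL (Fin 2) K) {s : Kˣ} (hs : Valued.v (s : K) = 1) {c : K} (hc : c ≠ 0)
    (h : {M : Submodule 𝒪[K] (Fin 2 → K) | IsSelfDualLattice σ ϖ H M ∧ mapGL g M = M ∧
        M.map ((Matrix.toLin' ((g : Matrix (Fin 2) (Fin 2) K) - ((g : Matrix (Fin 2) (Fin 2) K).trace / 2) • (1 : Matrix (Fin 2) (Fin 2) K))).restrictScalars 𝒪[K]) ≤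
          scaleLattice c M} = ∅) :
    {M : Submodule 𝒪[K] (Fin 2 → K) | IsSelfDualLattice σ ϖ H M ∧ mapGL (k⁻¹ * (Matrix.GeneralLinearGroup.scalar (Fin 2) s * g) * k) M = M ∧
        M.map ((Matrix.toLin' (((k⁻¹ * (Matrix.GeneralLinearGroup.scalar (Fin 2) s * g) * k : GL (Fin 2) K) : Matrix (Fin 2) (Fin 2) K) -
          (((k⁻¹ * (Matrix.GeneralLinearGroup.scalar (Fin 2) s * g) * k : GL (Fin 2) K) : Matrix (Fin 2) (Fin 2) K).trace / 2) • (1 : Matrix (Fin 2) (Fin 2) K))).restrictScalars 𝒪[K]) ≤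
          scaleLattice c M} = ∅ := by
  refine Set.eq_empty_iff_forall_notMem.2 fun B hB => ?_
  have h' := mapGL_mem_centredBall_of_mem_centredBall_inv_conj_scalar_mul (ϖ := ϖ) H hk g hs hc hB
  rw [h] at h'
  exact h'

end Transport

end Literature.NumberTheory.Automorphic.UnitaryLatticeTree

/-! ## §2 The CM dress: regime A-even, `#R = q + 1` at level `ϖ^{N−1}` -/

namespace Literature.NumberTheory.Rogawski1990.BlockLawHyp

variable (L : Type) [Field L] [NumberField L] [IsCMField L] {v : HeightOneSpectrum (𝓞 ↥(maximalRealSubfield L))}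
  (w : PlacesOver L v) (hw : IsCMField.complexConj L • w.1 = w.1)

set_option maxHeartbeats 800000 in
-- budget only: statement-heavy CM tokens.
/-- **`#R` OF THE HYPERBOLIC LITERAL, REGIME A-EVEN** (`N = 2n = m`): the root region of `Γ = ι(k⁻¹(s·ĝ_w)k, 1)` at level `ϖ^{2n−1}` has `q + 1` members — ★ (4c-ii)
`ncard_rootRegion_eq_ncard_two_of_top` (`hα` = chair clause 3, `htop` = A-p12's empty top ball transported by §1, finite by ★ F0P3a-p05) ∘ ★ FILE 4
`ncard_selfDual_fixed_lev_rerootedCentred_eq_ncard_ball_ram` (`d := 2n−1`) ∘ ★ A-p12 `selfDual_fixed_ball_odd_scale_eq` (`2(n−1)+1 ↝ 2(n−1)`) ∘ `ncard_selfDual_fixed_ball_of_even_depth_ramified`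
(`j := n−1`). [cite: Kottwitz1986, §3] [cite: Rogawski1990, §4.9 Lemma 4.9.3] [cite: LabesseLanglands1979, §2 Lemma 2.1] -/
theorem ncard_rootRegion_hyperbolic_of_even_A_ram (he : v.asIdeal.ramificationIdx' w.1.asIdeal ≠ 1)
    (h2 : IsUnit (2 : (ValuativeRel.valuation (w.1.adicCompletion L)).integer))
    (ϖ : w.1.adicCompletion L) (hϖ : Valued.v ϖ = WithZero.exp (-1 : ℤ)) (hσϖ : galAdicCompletionMap (L := L) (IsCMField.complexConj L) hw ϖ = -ϖ)
    (γH : (cmDatum L 2 (Matrix.of fun i j : Fin 2 => if i.val + j.val + 1 = 2 then (1 : L) else 0)).Local v ×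
      (cmDatum L 1 (Matrix.of fun i j : Fin 1 => if i.val + j.val + 1 = 1 then (1 : L) else 0)).Local v)
    (hblk : ∀ i j : Fin 2, Valued.v (((((γH.1.val : GL (Fin 2) (UnitaryGroup.LocalRing L v)).val.map (Pi.evalRingHom (fun w' : PlacesOver L v => w'.1.adicCompletion L) w))) - 1) i j) ≤ Valued.v (ϖ ^ 2))
    (hu2 : Valued.v (finGammaTwo L v γH w - 1) ≤ Valued.v (ϖ ^ 2))
    (hirr : ¬ ∃ x : (w.1.adicCompletion L), ((((γH.1.val : GL (Fin 2) (UnitaryGroup.LocalRing L v)).val.map (Pi.evalRingHom (fun w' : PlacesOver L v => w'.1.adicCompletion L) w))).charpoly).IsRoot x)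
    {n : ℕ}
    (hdisc : Valued.v ((((γH.1.val : GL (Fin 2) (UnitaryGroup.LocalRing L v)).val.map (Pi.evalRingHom (fun w' : PlacesOver L v => w'.1.adicCompletion L) w))).trace ^ 2 - 4 * (((γH.1.val : GL (Fin 2) (UnitaryGroup.LocalRing L v)).val.map (Pi.evalRingHom (fun w' : PlacesOver L v => w'.1.adicCompletion L) w))).det) = WithZero.exp (-((2 * (2 * n) : ℕ) : ℤ)))
    (hn : 1 ≤ n)
    (m : ℕ) (hm : Valued.v (((finCharpolyTwo L v γH).eval (finGammaTwo L v γH)) w) =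
      Valued.v ((toPlace v w (HeckeCharacter.uniformizer ↥(maximalRealSubfield L) v : v.adicCompletion ↥(maximalRealSubfield L))) ^ m))
    (β : (v.adicCompletion ↥(maximalRealSubfield L))ˣ)
    (hβ : toPlace v w (β : v.adicCompletion ↥(maximalRealSubfield L)) =
      -(((finCharpolyTwo L v γH).eval (finGammaTwo L v γH)) w *
          (finGammaTwo L v γH w ^ 2 + ((γH.1.val.val : Matrix (Fin 2) (Fin 2) (LocalRing L v)).map (Pi.evalRingHom (fun w' : PlacesOver L v => w'.1.adicCompletion L) w)).det)) /
        (2 * finGammaTwo L v γH w ^ 2 * ((γH.1.val.val : Matrix (Fin 2) (Fin 2) (LocalRing L v)).map (Pi.evalRingHom (fun w' : PlacesOver L v => w'.1.adicCompletion L) w)).det))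
    (s : (w.1.adicCompletion L)ˣ)
    (hs : (s : w.1.adicCompletion L) * (((localNonsplitEquiv (IsCMField.complexConj L) (Matrix.of fun i j : Fin 1 => if i.val + j.val + 1 = 1 then (1 : L) else 0)
        (IsCMField.complexConj_ne_one L) w hw γH.2).val : GL (Fin 1) (w.1.adicCompletion L)) : Matrix (Fin 1) (Fin 1) (w.1.adicCompletion L)) 0 0 = 1)
    (k : GL (Fin 2) (w.1.adicCompletion L))
    (hk : k ∈ unitaryGroupOfForm (galAdicCompletionMap (L := L) (IsCMField.complexConj L) hw)
      (placeForm (Matrix.of fun i j : Fin 2 => if i.val + j.val + 1 = 2 then (1 : L) else 0) w.1))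
    (γ : unitaryGroupOfForm (galAdicCompletionMap (L := L) (IsCMField.complexConj L) hw) ((StdForm.antidiagonal 3).over (w.1.adicCompletion L)))
    (hγ : (γ : GL (Fin 3) (w.1.adicCompletion L)) = endoGL (k⁻¹ * (Matrix.GeneralLinearGroup.scalar (Fin 2) s *
        ((localNonsplitEquiv (IsCMField.complexConj L) (Matrix.of fun i j : Fin 2 => if i.val + j.val + 1 = 2 then (1 : L) else 0)
          (IsCMField.complexConj_ne_one L) w hw γH.1).val : GL (Fin 2) (w.1.adicCompletion L))) * k, (1 : GL (Fin 1) (w.1.adicCompletion L))))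
    (hmN : m = 2 * n) :
    {x : {M : Submodule (Valued.integer (w.1.adicCompletion L)) (Fin 3 → (w.1.adicCompletion L)) //
          IsVertex (galAdicCompletionMap (L := L) (IsCMField.complexConj L) hw) ϖ ((StdForm.antidiagonal 3).over (w.1.adicCompletion L)) M} |
        latticeGraphIso (galAdicCompletionMap (L := L) (IsCMField.complexConj L) hw) ϖ ((StdForm.antidiagonal 3).over (w.1.adicCompletion L)) γ x = x ∧
          IsSelfDualLattice (galAdicCompletionMap (L := L) (IsCMField.complexConj L) hw) ϖ ((StdForm.antidiagonal 3).over (w.1.adicCompletion L)) x.1 ∧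
          x.1.map ((Matrix.toLin' (((γ : GL (Fin 3) (w.1.adicCompletion L)) : Matrix (Fin 3) (Fin 3) (w.1.adicCompletion L)) - 1)).restrictScalars
            (Valued.integer (w.1.adicCompletion L))) ≤ scaleLattice (ϖ ^ (2 * n - 1)) x.1}.ncard =
      Nat.card (𝓞 ↥(maximalRealSubfield L) ⧸ v.asIdeal) + 1 := by
  haveI := isPrincipalIdealRing_integer_adicCompletion L v w
  have hϖ0 : ϖ ≠ 0 := fun h0 => by rw [h0, map_zero] at hϖ; exact WithZero.coe_ne_zero hϖ.symm
  have hϖ1 : Valued.v ϖ ≤ 1 := by rw [hϖ, ← WithZero.exp_zero]; exact WithZero.exp_le_exp.2 (by norm_num)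
  have h2w : Valued.v (2 : (w.1.adicCompletion L)) = 1 := (isUnit_two_integer_iff_valued_eq_one L w.1).1 h2
  have hvσ : ∀ x, Valued.v (galAdicCompletionMap (L := L) (IsCMField.complexConj L) hw x) = Valued.v x :=
    fun x => valued_galAdicCompletionMap (L := L) (IsCMField.complexConj L) hw x
  have hσ : ∀ a, galAdicCompletionMap (L := L) (IsCMField.complexConj L) hw (galAdicCompletionMap (L := L) (IsCMField.complexConj L) hw a) = a :=
    galAdicCompletionMap_galAdicCompletionMap_of_smul_eq (IsCMField.complexConj L) w (IsCMField.complexConj_ne_one L) hw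
  have hu1 := v_oneByOne_eq_one_of_local L w hw γH.2
  have hsv : Valued.v (s : w.1.adicCompletion L) = 1 := by
    have h := congrArg Valued.v hs
    rwa [map_mul, hu1, mul_one, map_one] at h
  -- the dictionary, regime A-even: `|2û − tr ĝ| < |ϖ^(2n)|`
  obtain ⟨-, -, hA⟩ := typeTwo_depthDictionary_even_ram L w hw he h2 ϖ hϖ hσϖ hblk hu2 hirr hdisc m hm β hβ
  have hlt := (hA hmN).2
  -- `Φ₂,w = !![0,1;1,0]` and the memberships
  have hk' : k ∈ unitaryGroupOfForm (galAdicCompletionMap (L := L) (IsCMField.complexConj L) hw) (!![(0 : w.1.adicCompletion L), 1; 1, 0] : Matrix (Fin 2) (Fin 2) (w.1.adicCompletion L)) := by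
    rw [← stdForm_antidiagonal_two_over_eq, ← placeForm_antidiagOne]; exact hk
  have hg' : ((localNonsplitEquiv (IsCMField.complexConj L) (Matrix.of fun i j : Fin 2 => if i.val + j.val + 1 = 2 then (1 : L) else 0)
      (IsCMField.complexConj_ne_one L) w hw γH.1).val : GL (Fin 2) (w.1.adicCompletion L)) ∈
        unitaryGroupOfForm (galAdicCompletionMap (L := L) (IsCMField.complexConj L) hw) (!![(0 : w.1.adicCompletion L), 1; 1, 0] : Matrix (Fin 2) (Fin 2) (w.1.adicCompletion L)) := by
    rw [← stdForm_antidiagonal_two_over_eq, ← placeForm_antidiagOne]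
    exact (localNonsplitEquiv (IsCMField.complexConj L) _ (IsCMField.complexConj_ne_one L) w hw γH.1).2
  have hγU : k⁻¹ * (Matrix.GeneralLinearGroup.scalar (Fin 2) s *
      ((localNonsplitEquiv (IsCMField.complexConj L) (Matrix.of fun i j : Fin 2 => if i.val + j.val + 1 = 2 then (1 : L) else 0)
        (IsCMField.complexConj_ne_one L) w hw γH.1).val : GL (Fin 2) (w.1.adicCompletion L))) * k ∈
        unitaryGroupOfForm (galAdicCompletionMap (L := L) (IsCMField.complexConj L) hw) (!![(0 : w.1.adicCompletion L), 1; 1, 0] : Matrix (Fin 2) (Fin 2) (w.1.adicCompletion L)) :=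
    Subgroup.mul_mem _ (Subgroup.mul_mem _ (Subgroup.inv_mem _ hk')
      (scalar_mul_mem_unitaryGroupOfForm hg' s (map_mul_self_eq_one_of_mul_oneByOne_eq_one (oneByOne_mem_unitaryGroupOfForm_antidiagonal_of_local L w hw γH.2) hs))) hk'
  -- `hα`: the scalar part of `B₀` is deeper than `N − 1`
  have hα : Valued.v (((k⁻¹ * (Matrix.GeneralLinearGroup.scalar (Fin 2) s *
      ((localNonsplitEquiv (IsCMField.complexConj L) (Matrix.of fun i j : Fin 2 => if i.val + j.val + 1 = 2 then (1 : L) else 0)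
        (IsCMField.complexConj_ne_one L) w hw γH.1).val : GL (Fin 2) (w.1.adicCompletion L))) * k : GL (Fin 2) (w.1.adicCompletion L)) :
          Matrix (Fin 2) (Fin 2) (w.1.adicCompletion L)).trace / 2 - (((1 : GL (Fin 1) (w.1.adicCompletion L)) : Matrix (Fin 1) (Fin 1) (w.1.adicCompletion L)) 0 0)) ≤
      Valued.v (ϖ ^ (2 * n - 1 + 1)) := by
    rw [Units.val_one, Matrix.one_apply_eq, trace_coe_inv_conj_scalar_mul, mul_div_assoc, v_mul_trace_div_two_sub_one_eq h2w hs hsv, coe_localNonsplitEquiv_apply,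
      show 2 * n - 1 + 1 = 2 * n by omega]
    exact hlt.le
  -- `htop`: no W-vertex of centred depth `N` (A-p12's top ball of `ĝ_w` is empty; transported to `B₀` by §1)
  have hfin := finite_selfDual_fixed_of_even_depth_ramified L v w hw he h2 (Units.mk0 ϖ hϖ0) hϖ hσϖ γH.1 hirr hdisc hn
  have hzero := ncard_selfDual_fixed_ball_top_of_even_depth_ramified L v w hw he h2 (Units.mk0 ϖ hϖ0) hϖ hσϖ γH.1 hirr hblk hn hdisc
  simp only [Units.val_mk0] at hfin hzero
  have hempty := (Set.ncard_eq_zero (hfin.subset fun B hB => ⟨by rw [placeForm_antidiagOne, stdForm_antidiagonal_two_over_eq]; exact hB.1, hB.2.1⟩)).1 hzero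
  have htop := centredBall_inv_conj_scalar_mul_eq_empty (ϖ := ϖ) _ hk' _ hsv (pow_ne_zero (2 * n) hϖ0) hempty
  rw [show 2 * n = 2 * n - 1 + 1 by omega] at htop
  -- (4c-ii) at `u := 1`, then FILE 4's W-side transport at `d := 2n − 1`
  rw [ncard_rootRegion_eq_ncard_two_of_top hσ hvσ hϖ h2w γ _ 1 hγ hγU (by rw [Units.val_one, Matrix.one_apply_eq, map_one])
    (by rw [Units.val_one, Matrix.one_apply_eq, sub_self, map_zero]; exact zero_le) hα htop]
  have hsc : Valued.v (2 * finGammaTwo L v γH w - ((((γH.1.val : GL (Fin 2) (UnitaryGroup.LocalRing L v)).val.map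
      (Pi.evalRingHom (fun w' : PlacesOver L v => w'.1.adicCompletion L) w)))).trace) ≤ Valued.v (ϖ ^ (2 * n - 1)) :=
    hlt.le.trans (by rw [map_pow, map_pow]; exact pow_le_pow_right_of_le_one' hϖ1 (by omega))
  rw [ncard_selfDual_fixed_lev_rerootedCentred_eq_ncard_ball_ram L w hw he h2 ϖ hϖ γH s hs k hk (2 * n - 1) hsc]
  -- odd-scale collapse `2(n−1)+1 ↝ 2(n−1)` (`N = 2n ≠ 2(n−1)`), then the even-depth ball count at `j = n − 1`
  have e := selfDual_fixed_ball_odd_scale_eq L v w hw he h2 (Units.mk0 ϖ hϖ0) hϖ hσϖ (ϖ' := ϖ) _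
    (localNonsplitEquiv (IsCMField.complexConj L) _ (IsCMField.complexConj_ne_one L) w hw γH.1).2 hblk (N := 2 * n) hdisc (j := n - 1) (by omega)
  have c := ncard_selfDual_fixed_ball_of_even_depth_ramified L v w hw he h2 (Units.mk0 ϖ hϖ0) hϖ hσϖ γH.1 hirr hblk hdisc (j := n - 1) (by omega)
  simp only [Units.val_mk0] at e c
  rw [show 2 * n - 1 = 2 * (n - 1) + 1 by omega, e, c, show n - (n - 1) = 1 by omega, Finset.sum_range_one, pow_zero, mul_one]

end Literature.NumberTheory.Rogawski1990.BlockLawHyp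

end
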